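import Summits.CriticalPhenomena.SAWScalingLimit.Theses.SAWDefectDecoherence

/-!
# Sketch (crux-ideate round 2, ideator 6) — crux `MassRatio` (stmt-CriticalPhenomena-8550)

Card `flat-root-arc-swap`: move the root from the wild boundary point `a_δ` to the flat lattice
piece at `b` (RootSwap, a separation / root-insensitivity statement, predicted exponent `0`),
AVERAGE the swapped root over a far arc `S_δ` of the flat piece, and use the rows clause to
sandwich the `b`-side in the explicit lattice half-disc `H_δ = Λ_δ ∩ B(b, 3ρ/4)`.  Then
`MassRatio(c + ε) ⟸ RootSwap(ε) ∧ ArcMassRatio(c)`, where `ArcMassRatio` has NO pointwise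
quantity: its boundary side is the mass from the ROOT `b_δ` to the ARC `S_δ` inside `H_δ`
(a tame-root arc mass, sum-rule world) and its bulk side is the arc-rooted bulk mass.
Everything is over existing declarations; `FirstLemma` is the composition (provable now, size M:
sum RootSwap over `a' ∈ S_δ`, domain monotonicity `domainMono` for `H_δ ⊆ Λ_δ`, divide).
-/

namespace Summit.CriticalPhenomena.SAWScalingLimit.Cruxes.MassRatio.IdeatorSix

open Literature.Probability.LatticeModels Literature.Probability.RandomPlanarGeometry
open Literature.Probability.RandomPlanarGeometry.SAW
open Summit.CriticalPhenomena.SAWScalingLimit.Theses.SAWDefectDecoherence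

noncomputable section
open scoped Classical

/-- `σ = 0` mass `Z_Λ(r → z) = Σ_{γ ⊂ Λ : r → z} x_c^{ℓ(γ)}` (norm of the spin-0 observable). -/
def Zm (Λ : Finset HexVertex) (r z : Sym2 HexVertex) : ℝ :=
  ‖hexParafermionicObservable Λ r hexCriticalFugacity 0 z‖

/-- The hypothesis frame of `MassRatio` (verbatim conjuncts), as one predicate on the data. -/
def Frame (D : DobrushinDomain) (ρ : ℝ) (Λ : ℝ → Finset HexVertex) (m : ℝ → ℤ)
    (a b : ℝ → Sym2 HexVertex) : Prop :=
  0 < ρ ∧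
  D.carrier ∩ Metric.ball (D.pt 1) ρ = {z : ℂ | (D.pt 1).im < z.im} ∩ Metric.ball (D.pt 1) ρ ∧
  (∀ᶠ δ : ℝ in nhdsWithin 0 (Set.Ioi 0),
      hexDomainSimplyConnected (Λ δ) ∧ a δ ∈ hexDomainBoundary (Λ δ) ∧ b δ ∈ hexDomainBoundary (Λ δ) ∧
      Nonempty (HexMidEdgeSAW (Λ δ) (a δ) (b δ)) ∧
      (hexGraph.induce ((Λ δ : Finset HexVertex) : Set HexVertex)).Preconnected ∧
      (∀ v ∈ Λ δ, (δ : ℂ) * hexCenter v ∈ D.carrier) ∧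
      (∀ v : HexVertex, (δ : ℂ) * hexCenter v ∈ Metric.ball (D.pt 1) ρ → (v ∈ Λ δ ↔ m δ ≤ v.1 1))) ∧
  (∀ K : Set ℂ, IsCompact K → K ⊆ D.carrier → ∀ᶠ δ : ℝ in nhdsWithin 0 (Set.Ioi 0),
      ∀ v : HexVertex, (δ : ℂ) * hexCenter v ∈ K → v ∈ Λ δ) ∧
  Filter.Tendsto (fun δ : ℝ => (δ : ℂ) * hexMidpoint (a δ)) (nhdsWithin 0 (Set.Ioi 0)) (nhds (D.pt 0)) ∧
  Filter.Tendsto (fun δ : ℝ => (δ : ℂ) * hexMidpoint (b δ)) (nhdsWithin 0 (Set.Ioi 0)) (nhds (D.pt 1))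

/-- The SWAP ARC `S_δ`: boundary mid-edges of `Λ_δ` whose scaled midpoint lies at distance
between `ρ/4` and `ρ/2` from `b = D.pt 1` (by flatness + the rows clause these are exactly the
mid-edges of the flat zigzag piece there; `#S_δ ≍ ρ/δ`). -/
def swapArc (D : DobrushinDomain) (ρ : ℝ) (Λ : ℝ → Finset HexVertex) (δ : ℝ) : Set (Sym2 HexVertex) :=
  {e | e ∈ hexDomainBoundary (Λ δ) ∧ ρ / 4 ≤ dist ((δ : ℂ) * hexMidpoint e) (D.pt 1) ∧
        dist ((δ : ℂ) * hexMidpoint e) (D.pt 1) ≤ ρ / 2}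

/-- Normalised `K`-mass from the root `r`: `δ² Σ_{e : δ·mid e ∈ K} Z_Λ(r → e)` (the crux's LHS for `r = a_δ`). -/
def massK (Λ : Finset HexVertex) (r : Sym2 HexVertex) (δ : ℝ) (K : Set ℂ) : ℝ :=
  δ ^ 2 * ∑ᶠ e ∈ {e : Sym2 HexVertex | e ∈ hexDomainMidEdges Λ ∧ (δ : ℂ) * hexMidpoint e ∈ K}, Zm Λ r e

/-- The local lattice half-disc `H_δ := Λ_δ ∩ B(b, 3ρ/4)` (a lattice-exact half-disc with flat
zigzag bottom by the rows clause; tame for sum rules rooted at `b_δ`). -/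
def halfDisc (D : DobrushinDomain) (ρ : ℝ) (Λ : ℝ → Finset HexVertex) (δ : ℝ) : Finset HexVertex :=
  (Λ δ).filter (fun v => dist ((δ : ℂ) * hexCenter v) (D.pt 1) < 3 * ρ / 4)

/-- `MassRatio` at exponent cut `c` (the crux is `MassRatioAt (3/4)` after unfolding `Zm`, `massK`). -/
def MassRatioAt (c : ℝ) : Prop :=
  ∀ (D : DobrushinDomain) (ρ : ℝ) (Λ : ℝ → Finset HexVertex) (m : ℝ → ℤ) (a b : ℝ → Sym2 HexVertex),
    Frame D ρ Λ m a b → ∀ K : Set ℂ, IsCompact K → K ⊆ D.carrier → ∃ C : ℝ,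
      ∀ᶠ δ : ℝ in nhdsWithin 0 (Set.Ioi 0), massK (Λ δ) (a δ) δ K ≤ C * δ ^ (-c) * Zm (Λ δ) (a δ) (b δ)

/-- STUB 1 — **RootSwap(ε)** (root insensitivity / separation, a cross-ratio inequality between
four `σ = 0` masses; predicted TRUE with `ε = 0`, constant depending on the frame and `K`):
`Z(a→K)·Z(b→a') ≤ C δ^{-ε} Z(a→b)·Z(a'→K)` for every `a'` in the swap arc. Uses exhaustion
quantitatively (false for the Disproof's exhaustion-free corridor family `Λ₃`). -/
def RootSwap (ε : ℝ) : Prop :=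
  ∀ (D : DobrushinDomain) (ρ : ℝ) (Λ : ℝ → Finset HexVertex) (m : ℝ → ℤ) (a b : ℝ → Sym2 HexVertex),
    Frame D ρ Λ m a b → ∀ K : Set ℂ, IsCompact K → K ⊆ D.carrier → ∃ C : ℝ,
      ∀ᶠ δ : ℝ in nhdsWithin 0 (Set.Ioi 0), ∀ a' ∈ swapArc D ρ Λ δ,
        massK (Λ δ) (a δ) δ K * Zm (Λ δ) (b δ) a' ≤ C * δ ^ (-ε) * Zm (Λ δ) (a δ) (b δ) * massK (Λ δ) a' δ K

/-- STUB 1' — **RootSwapArc(ε)**, the AVERAGED form actually consumed by the first lemma (weaker than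
`RootSwap ε`: sum the cross-ratio inequality over `a' ∈ S_δ`):
`Z(a→K) · Z_Λ(b→S_δ) ≤ C δ^{-ε} · Z(a→b) · Σ_{a'∈S_δ} Z(a'→K)`. -/
def RootSwapArc (ε : ℝ) : Prop :=
  ∀ (D : DobrushinDomain) (ρ : ℝ) (Λ : ℝ → Finset HexVertex) (m : ℝ → ℤ) (a b : ℝ → Sym2 HexVertex),
    Frame D ρ Λ m a b → ∀ K : Set ℂ, IsCompact K → K ⊆ D.carrier → ∃ C : ℝ,
      ∀ᶠ δ : ℝ in nhdsWithin 0 (Set.Ioi 0),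
        massK (Λ δ) (a δ) δ K * ∑ᶠ a' ∈ swapArc D ρ Λ δ, Zm (Λ δ) (b δ) a' ≤
          C * δ ^ (-ε) * Zm (Λ δ) (a δ) (b δ) * ∑ᶠ a' ∈ swapArc D ρ Λ δ, massK (Λ δ) a' δ K

/-- STUB 2 — **ArcMassRatio(c)**: the crux with the root moved onto the flat piece and AVERAGED
over the swap arc; boundary side = mass from the tame ROOT `b_δ` to the ARC `S_δ` inside the
explicit half-disc `H_δ` (no pointwise quantity; predicted exponents: LHS `δ^{-13/48}`,
RHS arc mass `δ^{12/48}`, so true for `c ≥ 25/48`). This is where both sharp exponent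
certifications live (see the card's Transfer and the NECESSITY note). -/
def ArcMassRatio (c : ℝ) : Prop :=
  ∀ (D : DobrushinDomain) (ρ : ℝ) (Λ : ℝ → Finset HexVertex) (m : ℝ → ℤ) (a b : ℝ → Sym2 HexVertex),
    Frame D ρ Λ m a b → ∀ K : Set ℂ, IsCompact K → K ⊆ D.carrier → ∃ C : ℝ,
      ∀ᶠ δ : ℝ in nhdsWithin 0 (Set.Ioi 0),
        ∑ᶠ a' ∈ swapArc D ρ Λ δ, massK (Λ δ) a' δ K ≤
          C * δ ^ (-c) * ∑ᶠ a' ∈ swapArc D ρ Λ δ, Zm (halfDisc D ρ Λ δ) (b δ) a'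

/-- Domain monotonicity of `σ = 0` masses (provable now: walks of `Λ'` are walks of `Λ`). -/
def DomainMono : Prop :=
  ∀ (Λ Λ' : Finset HexVertex) (r z : Sym2 HexVertex), Λ' ⊆ Λ → Zm Λ' r z ≤ Zm Λ r z

/-- **FIRST LEMMA** (provable now, size M): sum RootSwap over `a' ∈ S_δ`, bound the arc-rooted
bulk mass by ArcMassRatio, push `Z_{H_δ}(b_δ → a') ≤ Z_{Λ_δ}(b_δ → a')` by `DomainMono`, and
divide by the (eventually positive) arc mass `Σ_{a'∈S_δ} Z_{Λ_δ}(b_δ → a')`. -/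
def FirstLemma : Prop :=
  ∀ ε c : ℝ, 0 ≤ ε → 0 ≤ c → RootSwapArc ε → ArcMassRatio c → MassRatioAt (c + ε)

/-- `RootSwap ε → RootSwapArc ε` (sum over the finite arc; provable now, size S). -/
def RootSwap_implies_arc : Prop := ∀ ε : ℝ, RootSwap ε → RootSwapArc ε

/-- The crux from the two stubs at the filed cut. -/
def LineTarget : Prop := ∀ ε : ℝ, 0 ≤ ε → ε ≤ 3 / 4 → RootSwapArc ε → ArcMassRatio (3 / 4 - ε) → MassRatio

/-- `DomainMono` holds (the injection `HexMidEdgeSAW Λ' r z ↪ HexMidEdgeSAW Λ r z`). -/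
theorem domainMono : DomainMono := by
  intro Λ Λ' r z hsub
  unfold Zm
  rw [hexParafermionicObservable_zero_spin, hexParafermionicObservable_zero_spin,
    Complex.norm_real, Complex.norm_real]
  have hx : 0 ≤ hexCriticalFugacity := hexCriticalFugacity_pos_lt_one.1.le
  have h1 : 0 ≤ ∑ γ : HexMidEdgeSAW Λ' r z, hexCriticalFugacity ^ γ.length :=
    Finset.sum_nonneg fun γ _ => pow_nonneg hx _
  have h2 : 0 ≤ ∑ γ : HexMidEdgeSAW Λ r z, hexCriticalFugacity ^ γ.length :=
    Finset.sum_nonneg fun γ _ => pow_nonneg hx _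
  rw [Real.norm_of_nonneg h1, Real.norm_of_nonneg h2]
  -- the injection
  let ι : HexMidEdgeSAW Λ' r z → HexMidEdgeSAW Λ r z := fun γ =>
    { verts := γ.verts
      subset := fun v hv => hsub (γ.subset v hv)
      nodup := γ.nodup
      isChain := γ.isChain
      head_mem := γ.head_mem
      getLast_mem := γ.getLast_mem
      eq_of_nil := γ.eq_of_nil
      edges_nodup := γ.edges_nodup
      fst_mem := by
        obtain ⟨he, v, hv, hvΛ⟩ := γ.fst_mem
        exact ⟨he, v, hv, hsub hvΛ⟩ }
  have hι : Function.Injective ι := by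
    intro γ₁ γ₂ h
    have : (ι γ₁).verts = (ι γ₂).verts := by rw [h]
    exact HexMidEdgeSAW.ext this
  have hlen : ∀ γ, (ι γ).length = γ.length := fun γ => rfl
  calc ∑ γ : HexMidEdgeSAW Λ' r z, hexCriticalFugacity ^ γ.length
      = ∑ γ : HexMidEdgeSAW Λ' r z, hexCriticalFugacity ^ (ι γ).length := by simp only [hlen]
    _ = ∑ γ ∈ (Finset.univ : Finset (HexMidEdgeSAW Λ' r z)).map ⟨ι, hι⟩,
          hexCriticalFugacity ^ γ.length := by rw [Finset.sum_map]; rfl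
    _ ≤ ∑ γ : HexMidEdgeSAW Λ r z, hexCriticalFugacity ^ γ.length :=
        Finset.sum_le_sum_of_subset_of_nonneg (Finset.subset_univ _) fun γ _ _ => pow_nonneg hx _

end

end Summit.CriticalPhenomena.SAWScalingLimit.Cruxes.MassRatio.IdeatorSix
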